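import Summits.BirchSwinnertonDyer.BirchSwinnertonDyer.Theorems.ByReductionTypeAtTwoAdditiveLowerHalfDoors
import HarnessLib

/-!
# Crux `AdditiveRankZeroAtTwo` (K4 item 19098): the ONE-SIDED over-`K` supply roads into the Eisenstein half (v2.2 child
# C3″ `AdditivePotGoodLowerHalfAtTwo`) are EXACT — seat `bsd-2adic-addL2x` GEN 11

Cell `bsd-2adic`, rung K4, crux stmt-BirchSwinnertonDyer-19098, line add_twist_overK v2. `--supports 19098 --as helper`.
HONEST FRAMING (D-0036/D-0054): conditional theorems; closes nothing at the `∀`-level; nothing booked; BSD is not proved by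
any of this.

WHAT THIS FILE DOES. `…AdditiveLowerHalfDoors.lean` (p629807) reaches C3″ from the LOWER half over an inert quadratic
field on the defect-`≥ 3` block (`hKClow`) and over a twist-semistabilising field on the `C₂` sub-class (`hQKlow`). Here
the converses: the two one-sided over-`K` `∀`-objects are not stronger than what C3″ asserts.
* §1 `lowerOverC_of_lower_lower` — the pair identity `def(V) = def(W) + def(Wd)` read the third way: the LOWER halves
  over `ℚ` at `W` and at the twist `Wd` give the LOWER half over `K` on any `K`-model `V` (any `p`); canonical-model form
  `lowerOverKC_of_lower_lower` (Milne, GZK discharged).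
* §2 `addDefect_lowerOverKC_iff_lower` — on the defect-`≥ 3` block, GRANTED PRINT {GZK, modularity, Milne any-model,
  Murty–Murty} and the Kato half on the block: `hKClow` ⟺ the Eisenstein half over `ℚ` on the block (`→` p629807;
  `←` §1 at the Murty–Murty twist, which stays in the block — the Kato half is used only in `→`).
* §3 `addQuadPotGood_lowerOverKC_iff_lower` — on the `C₂` sub-class, GRANTED PRINT {GZK, modularity, Milne any-model,
  Hoffstein–Luo} and the GOOD siblings 19095/19097: `hQKlow` ⟺ the Eisenstein half over `ℚ` on `C₂`.

References: [Milne1972ArithmeticAV] §1 Thm. 1 (through [DokchitserDokchitserAnnals2010] §2.1); [MurtyMurty1997] Ch. 6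
Thm. 1.2; [HoffsteinLuo1997]; [Miller2011LMS] Def. 1.1.
-/

set_option autoImplicit false
set_option linter.dupNamespace false

noncomputable section

open scoped Classical

namespace Summit.BirchSwinnertonDyer.BirchSwinnertonDyer.Theorems.AddKatoTwo

open WeierstrassCurve Literature.NumberTheory.EllipticCurves
  Literature.NumberTheory.EllipticCurves.ModularForms
  Literature.NumberTheory.EllipticCurves.Kato2004
  Literature.NumberTheory.EllipticCurves.Rank1Residual
  Literature.NumberTheory.EllipticCurves.Rank1Residual.Typed
  Literature.NumberTheory.IwasawaTheory
  Summit.BirchSwinnertonDyer.Rank1Residual Summit.BirchSwinnertonDyer.Rank1Residual.AdditivePotMult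
  Summit.BirchSwinnertonDyer.Rank1Residual.X5.AddTwoL2
  Summit.BirchSwinnertonDyer.BirchSwinnertonDyer.Theses.ByReductionTypeAtTwo

/-! ## §1 Two lower halves over `ℚ` ⇒ the lower half over `K` -/

section Mixed

variable (W : WeierstrassCurve ℚ) [W.IsElliptic] (p : ℕ) [Fact p.Prime]
  (K : Type) [Field K] [NumberField K]
  (Wd : WeierstrassCurve ℚ) [Wd.IsElliptic] (V : WeierstrassCurve K) [V.IsElliptic]

/-- **Lower halves over `ℚ` at `W` and at the twist `Wd` ⇒ lower half over `K` on any `K`-model `V` of `W_K`** (any `p`;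
hypotheses of (★) `AdditivePotMult.shaAnOverC_mul_eq`). With `#Ш_an(W) = q`, `#Ш_an(Wd) = q_d`,
`#Ш_an(V) = q·q_d·#Ш(V)/(#Ш(W)·#Ш(Wd))` (`exists_shaAnOverC_eq_of_rat`), so `def(V) = def(W) + def(Wd) ≤ 0`.
[cite: Milne1972ArithmeticAV, §1 Thm. 1 (through DokchitserDokchitserAnnals2010 §2.1)] [cite: Miller2011LMS, Def. 1.1] -/
theorem lowerOverC_of_lower_lower (hmod : hasEntireLFunction_rat) (h2 : Module.finrank ℚ K = 2)
    (hWd : ∃ C : VariableChange ℚ, C • W.quadraticTwist (NumberField.discr K : ℚ) = Wd)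
    (hV : ∃ C : VariableChange K, C • W.baseChange K = V)
    (hshaW : W.ShaFinite) (hshaD : Wd.ShaFinite) (hshaK : V.ShaFinite)
    (hWR : (V.shaOrder : ℝ) * V.regulator * V.bsdPeriod * (V.modifiedTamagawaProduct : ℝ) /
        (V.torsionOrder : ℝ) ^ 2 = W.bsdRHS * Wd.bsdRHS)
    (hl : MissingLowerBoundAt W p) (hld : MissingLowerBoundAt Wd p) : MissingLowerBoundOverCAt V p := by
  obtain ⟨q, hq, hle⟩ := hl
  obtain ⟨qd, hqd, hled⟩ := hld
  have hq' := exists_shaAnOverC_eq_of_rat W K Wd V hmod h2 hWd hV hshaW hshaD hWR hq hqd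
  refine ⟨_, hq', ?_⟩
  have hsW : W.shaOrder ≠ 0 := (W.shaOrder_pos hshaW).ne'
  have hsD : Wd.shaOrder ≠ 0 := (Wd.shaOrder_pos hshaD).ne'
  have hsK : V.shaOrder ≠ 0 := (V.shaOrder_pos hshaK).ne'
  have hsWq : (W.shaOrder : ℚ) ≠ 0 := by exact_mod_cast hsW
  have hsDq : (Wd.shaOrder : ℚ) ≠ 0 := by exact_mod_cast hsD
  have hsKq : (V.shaOrder : ℚ) ≠ 0 := by exact_mod_cast hsK
  have hq0 : q ≠ 0 := by
    intro h0; apply shaAn_ne_zero W hmod; rw [hq, h0, Rat.cast_zero]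
  have hqd0 : qd ≠ 0 := by
    intro h0; apply shaAn_ne_zero Wd hmod; rw [hqd, h0, Rat.cast_zero]
  rw [padicValRat.div (mul_ne_zero (mul_ne_zero hq0 hqd0) hsKq) (mul_ne_zero hsWq hsDq),
    padicValRat.mul (mul_ne_zero hq0 hqd0) hsKq, padicValRat.mul hq0 hqd0, padicValRat.mul hsWq hsDq,
    padicValRat.of_nat, padicValRat.of_nat, padicValRat.of_nat]
  push_cast at hle hled ⊢
  linarith

omit [W.IsElliptic] in
/-- Canonical model, Milne and GZK discharged: for `W/ℚ` globally minimal of analytic rank `≤ 1`, `K` quadratic, `Wd` a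
globally minimal model of `W^{(d_K)}` of analytic rank `≤ 1`: the lower halves over `ℚ` at `W` and `Wd` give
`MissingLowerBoundOverCAt (W.baseChange K) p`. [cite: Milne1972ArithmeticAV, §1 Thm. 1 (through DokchitserDokchitserAnnals2010 §2.1)] -/
theorem lowerOverKC_of_lower_lower [W.IsElliptic] [W.IsGloballyMinimal] [Wd.IsGloballyMinimal]
    (hGZK : rank_eq_analyticRank_of_analyticRank_le_one) (hmod : hasEntireLFunction_rat)
    (hMilneC : Milne1972.bsdQuotient_baseChange_quadratic_anyModel)
    (hr : W.analyticRank ≤ 1) (h2 : Module.finrank ℚ K = 2)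
    (hWd : ∃ C : VariableChange ℚ, C • W.quadraticTwist (NumberField.discr K : ℚ) = Wd)
    (hrd : Wd.analyticRank ≤ 1) (hl : MissingLowerBoundAt W p) (hld : MissingLowerBoundAt Wd p) :
    MissingLowerBoundOverCAt (W.baseChange K) p := by
  haveI : (W.baseChange K).IsElliptic := by rw [baseChange]; infer_instance
  have hV : ∃ C : VariableChange K, C • W.baseChange K = W.baseChange K := ⟨1, one_smul _ _⟩
  obtain ⟨-, hfinW⟩ := hGZK W hr
  obtain ⟨-, hfinD⟩ := hGZK Wd hrd
  obtain ⟨hshaK, hWR⟩ := hMilneC W K h2 Wd hWd (W.baseChange K) hV hfinW hfinD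
  exact lowerOverC_of_lower_lower W p K Wd (W.baseChange K) hmod h2 hWd hV hfinW hfinD hshaK hWR hl hld

end Mixed

/-! ## §2 Defect-`≥ 3` block: `hKClow` ⟺ the Eisenstein half over `ℚ`, granted the Kato half -/

/-- **EXACTNESS of the inert one-sided road.** GRANTED PRINT {`hGZK`, `hmod`, `hMilneC`, `hMM`} and the Kato half on the
defect-`≥ 3` block (`hU3`): the LOWER half over every admissible inert quadratic field on the canonical model (`hKClow`)
is EQUIVALENT to the Eisenstein half `MissingLowerBoundAt W 2` on the block. `→`: `addDefect_lower_of_upper_of_lowerOverKC_of_murtyMurty`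
(p629807, uses `hU3`); `←`: the twist by `d_K ≡ 5 (mod 8)` stays in the block
(`defectAtLeastThree_of_smul_quadraticTwist_of_emod_four_eq_one`), so the lower halves at `W` and at a minimal model of the
twist give the lower half over `K` (§1; `hU3` not used). [cite: MurtyMurty1997, Ch. 6 Thm. 1.2 with the deduction of Thm. 1.1 (pp. 93–94, 96)]
[cite: Milne1972ArithmeticAV, §1 Thm. 1 (through DokchitserDokchitserAnnals2010 §2.1)] -/
theorem addDefect_lowerOverKC_iff_lower
    (hGZK : rank_eq_analyticRank_of_analyticRank_le_one) (hmod : hasEntireLFunction_rat)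
    (hMilneC : Milne1972.bsdQuotient_baseChange_quadratic_anyModel)
    (hMM : murtyMurty_exists_twist_ne_zero_prescribedAtTwo)
    (hU3 : ∀ (W : WeierstrassCurve ℚ) [W.IsElliptic] [W.IsGloballyMinimal],
      ¬ W.HasCM → W.analyticRank = 0 → DefectAtLeastThree W → MissingUpperBoundAt W 2) :
    (∀ (W : WeierstrassCurve ℚ) [W.IsElliptic] [W.IsGloballyMinimal],
      ¬ W.HasCM → W.analyticRank = 0 → DefectAtLeastThree W →
      ∀ (K : Type) [Field K] [NumberField K], Module.finrank ℚ K = 2 → TwoInert K →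
        (W.quadraticTwist (NumberField.discr K : ℚ)).entireLFunction 1 ≠ 0 →
        MissingLowerBoundOverCAt (W.baseChange K) 2) ↔
    (∀ (W : WeierstrassCurve ℚ) [W.IsElliptic] [W.IsGloballyMinimal],
      ¬ W.HasCM → W.analyticRank = 0 → DefectAtLeastThree W → MissingLowerBoundAt W 2) := by
  haveI : Fact (Nat.Prime 2) := ⟨Nat.prime_two⟩
  refine ⟨fun hKClow => addDefect_lower_of_upper_of_lowerOverKC_of_murtyMurty hGZK hmod hMilneC hMM hU3 hKClow, ?_⟩
  intro hL3 W _ _ hcm hr hdef K _ _ h2 hin hL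
  have hd : (NumberField.discr K : ℚ) ≠ 0 := by exact_mod_cast NumberField.discr_ne_zero K
  haveI := W.isElliptic_quadraticTwist hd
  obtain ⟨C, hCmin⟩ := hasGlobalMinimalModel_rat_holds (W.quadraticTwist (NumberField.discr K : ℚ))
  haveI : (C • W.quadraticTwist (NumberField.discr K : ℚ)).IsGloballyMinimal := hCmin
  set Wd := C • W.quadraticTwist (NumberField.discr K : ℚ) with hWd_def
  have hWd : ∃ C' : VariableChange ℚ, C' • W.quadraticTwist (NumberField.discr K : ℚ) = Wd := ⟨C, rfl⟩
  have hcmd : ¬ Wd.HasCM := by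
    intro h
    apply hcm
    have h1 : (W.quadraticTwist (NumberField.discr K : ℚ)).HasCM :=
      (hasCM_iff_of_j_eq ((W.quadraticTwist (NumberField.discr K : ℚ)).variableChange_j C)).mp h
    exact (hasCM_iff_of_j_eq (W.j_quadraticTwist hd)).mp h1
  have hrd : Wd.analyticRank = 0 := by
    rw [hWd_def, analyticRank_smul]
    exact analyticRank_eq_zero_of_entireLFunction_one_ne_zero hL
  have hin4 : NumberField.discr K % 4 = 1 := by
    have h5 : NumberField.discr K % 8 = 5 := hin
    omega
  have hdefd : DefectAtLeastThree Wd :=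
    defectAtLeastThree_of_smul_quadraticTwist_of_emod_four_eq_one W Wd hin4 rfl hdef
  exact lowerOverKC_of_lower_lower W 2 K Wd hGZK hmod hMilneC (by omega) h2 hWd (by omega) (hL3 W hcm hr hdef)
    (hL3 Wd hcmd hrd hdefd)

/-! ## §3 `C₂` sub-class: `hQKlow` ⟺ the Eisenstein half over `ℚ`, granted the good siblings -/

/-- **EXACTNESS of lane A's one-sided road on `C₂`.** GRANTED PRINT {`hGZK`, `hmod`, `hMilneC`, `hHL`} and the GOOD sibling
cruxes `hOrd` (19095), `hSS` (19097): on the quadratic potentially-good sub-class, the LOWER half over every admissible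
twist-semistabilising quadratic field (`hQKlow`) is EQUIVALENT to the Eisenstein half `MissingLowerBoundAt W 2` there.
`→`: `addQuadPotGood_lower_of_goodSiblings_of_lowerOverKC` (p629807); `←`: the twist is GOOD at `2`
(`good_of_semistableTwist_of_padicValRat_j_nonneg`), `BSD₂(Wd)` by the siblings gives its lower half, §1.
[cite: Milne1972ArithmeticAV, §1 Thm. 1] [cite: HoffsteinLuo1997, Theorem] [cite: Miller2011LMS, §1 and Def. 1.1] -/
theorem addQuadPotGood_lowerOverKC_iff_lower
    (hGZK : rank_eq_analyticRank_of_analyticRank_le_one) (hmod : hasEntireLFunction_rat)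
    (hMilneC : Milne1972.bsdQuotient_baseChange_quadratic_anyModel)
    (hHL : HoffsteinLuo1997_exists_twist_L_one_ne_zero)
    (hOrd : GoodOrdinaryRankZeroAtTwo) (hSS : SupersingularRankZeroAtTwo) :
    (∀ (W : WeierstrassCurve ℚ) [W.IsElliptic] [W.IsGloballyMinimal], ¬ W.HasCM → W.analyticRank = 0 →
      Addv W 2 → 0 ≤ padicValRat 2 W.j → ∀ (K : Type) [Field K] [NumberField K], Module.finrank ℚ K = 2 →
        SemistableTwistAtTwo W K → (W.quadraticTwist (NumberField.discr K : ℚ)).entireLFunction 1 ≠ 0 →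
          MissingLowerBoundOverCAt (W.baseChange K) 2) ↔
    (∀ (W : WeierstrassCurve ℚ) [W.IsElliptic] [W.IsGloballyMinimal], ¬ W.HasCM → W.analyticRank = 0 →
      Addv W 2 → 0 ≤ padicValRat 2 W.j → QuadSemistabilisable W → MissingLowerBoundAt W 2) := by
  haveI : Fact (Nat.Prime 2) := ⟨Nat.prime_two⟩
  refine ⟨fun hQKlow => addQuadPotGood_lower_of_goodSiblings_of_lowerOverKC hGZK hmod hMilneC hHL hOrd hSS hQKlow, ?_⟩
  intro hL W _ _ hcm hr hadd hj K _ _ h2 hst hLtw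
  have hdK : (NumberField.discr K : ℚ) ≠ 0 := by exact_mod_cast NumberField.discr_ne_zero K
  have hq : QuadSemistabilisable W := ⟨(NumberField.discr K : ℚ), hdK, hst⟩
  obtain ⟨Wd, _, _, hWd, hcmd, hrd, hred⟩ := Theorems.exists_minimalTwist_semistable_rankZero W hcm K hst hLtw
  have hd : BSDp Wd 2 := by
    rcases good_of_semistableTwist_of_padicValRat_j_nonneg W hj hdK Wd hWd hred with hgo | hss
    · exact hOrd Wd hcmd hrd hgo
    · exact hSS Wd hcmd hrd hss
  have hrd1 : Wd.analyticRank ≤ 1 := by rw [hrd]; exact zero_le_one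
  haveI : Finite Wd.sha := (hGZK Wd hrd1).2
  have hld : MissingLowerBoundAt Wd 2 := (lower_and_upper_of_missingPPartAt Wd 2 (missingPPartAt_of_bsdp Wd 2 hd)).1
  exact lowerOverKC_of_lower_lower W 2 K Wd hGZK hmod hMilneC (by rw [hr]; exact zero_le_one) h2 hWd hrd1
    (hL W hcm hr hadd hj hq) hld

end Summit.BirchSwinnertonDyer.BirchSwinnertonDyer.Theorems.AddKatoTwo

end
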